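import Literature.MathematicalPhysics.QuantumFieldTheory.BalabanImbrieJaffe1984to88.BIJ88Eq5145HeadThreeCube
import Literature.MathematicalPhysics.QuantumFieldTheory.BalabanImbrieJaffe1984to88.BIJ88Ineq5144TwoCubeChi

/-!
# `BalabanImbrieJaffe1984to88.BIJ88Eq5145HeadThreeCubeChi` — T. Bałaban, J. Imbrie, A. Jaffe, *Effective action and cluster properties of the abelian
Higgs model*, Commun. Math. Phys. **114** (1988) 257–315 [BalabanImbrieJaffe1988], Sect. 5.14, (5.14.5) p. 312 [PDF 56] with (5.14.4) p. 309:
**THE C2.Eq5.14.5 HEAD `…_three_le_struct` WITH ITS REGIME CLAUSE C5 NARROWED TO THE V-HALF, AND ITS KERNEL CERTIFICATE ON TWO ABUTTING CUBES WITH A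
COUPLED PRECISION** — successor-head candidate by the owner's call (r16 → p36, 2026-08-23T01:36:52Z: *"file … the successor head `…_three_le_struct_chi`
(C5 narrowed to its V-half …) WITH its own Fin 2 coupled certificate, as a NEW head file (keep `BIJ88Eq5145HeadThreeCube` code-stable)"*; criteria
v2.195/v2.203: (1) conclusion VERBATIM by composition; (2) a displayed clause strictly weakened, every added clause print-kind and displayed with its
licensing sentence; (3) certificate = THAT theorem with every hypothesis discharged; (4) honest scope).

statement-level skeleton of published theorems with citation tags; proofs where landed; nothing here is a claim about the Yang–Mills mass gap

PDF held: `paper:balaban1988-cmp114-bij-abelian-higgs-effective-action` (journal page = PDF page + 256); pp. 307, 309, 310, 312 = PDF 51, 53, 54, 56.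
p. 312, verbatim: *"Altogether, we have shown that … = exp[−𝒫^L_{k+1,loc}(Λ₁₂^{(k)}) − Σ_{X⊂Λ₁₂^{(k)}} W₆^{(k)}(X)]. (5.14.5)"*; p. 309, verbatim: *"Let us
drop the prime, and prove that |g₃(H_β, X_β)| ≦ (e^β(L^kε/ε₀)^{1/4−α})^{[|H_β| + β′|X_β∖H_β|]}. (5.14.4) … Each t-derivative of a χ-factor in
χ′_{Λ₁₂^{(k)},t} gives at least a factor e^β(L^kε/ε₀)^{1/4−α}. … we obtain factors ct^{−n}e^{−cp(te_k)²} ≦ (e^β(L^kε/ε₀)^{1/4−α})ⁿ"* [licenses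
`hekθ : e_k ≤ θ` as THE per-derivative clause for χ-derivatives — in tree `BIJ88GaussFactor309.eK_le_vertex`]; p. 307, verbatim: *"If |X_α| = 1, with no
F^{m̄}_{k,loc}-factors, then we have the more precise bound |g₂(X_α) − 1| ≦ e^β(L^kε/ε₀)^{1/4−α}, obtained from the same estimates on the S_γ, S₅ sums,
and from extremely small factors when a χ′-factor is replaced by 1"* and p. 309, verbatim: *"the coefficient t in front of V^{(k)}(Y) plus a small power
of e_k easily beat the bounds A^{(k)}, φ^{(k)} ≦ cp(e_k)"* [license the two ADDED regime clauses `hreg₂` (one order more of the Gaussian shell: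
`n̄ + 3 ≤ κ(81/100)c₀²|log e_k⁻¹|^{2p−1}`) and `hχβ : 2e_k ≤ θ^{β′}` (one spare, extremely small shell factor pays the undecorated cube of a pair)];
p. 310, verbatim — THE LICENSE FOR THE KEPT V-HALF `hKθ₂`: *"It is now a standard exercise to estimate the expansion, using (5.14.4). The result is
|W₆^{(k)′}(X)| ≦ (e^β(L^kε/ε₀)^{1/4−α})^{n̄+1+β′|X|}. (We allow adjustments in β, α, β′, keeping them small.)"* [that `hKθ₂` is FORCED at model level
under every θ-per-letter typing of `V_Y`, `∇V_Y`, `∇²V_Y` is the pair of kernel witnesses p344699 `BIJ88Ineq5144PairAdjustmentWitness`, p346813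
`BIJ88Ineq5144PairGradientWitness`; HOME/GAPS.md G-C2-p36-09 + ADDENDA 1–2].

WHAT IS PROVED (unit `lit-balaban-p36`, generation 18 of the Phase-2 proof seat p36; SKELETON row **C2.Eq5.14.5** member / successor-head candidate of
`HOME/lit-balaban-r16/ROWS-C2-part2.md`, owner r16; row C2.Eq5.14.3-5.14.4 member).
* §1 **`eq5145_zG_mod_W6v_of_ineq5144_three_le_struct_chi`** — g17's head `BIJ88Eq5145HeadThreeCube.eq5145_zG_mod_W6v_of_ineq5144_three_le_struct`
  (conclusion VERBATIM: `exp[−𝒫^L − Σ_X (W₆′(X) + W₆″(X))]`) with: the χ-half `hekθ₂ : e_k ≤ θ^{1+β′}/2` of its declared adjustment REMOVED (the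
  χ-derivatives now cost exactly print's factor through the already-present one-cube clause `hekθ : e_k ≤ θ`); the regime clause `hreg` (order `n̄+2`)
  REPLACED by `hreg₂` (order `n̄+3`; implies `hreg`); the clause `hχβ : 2e_k ≤ θ^{β′}` ADDED; everything else — in particular the V-half
  `hKθ₂ : K_Y e^{2GK₁} ≤ θ^{1+β′}/2` — unchanged and in the same order.  Proof = the structural head `BIJ88Eq5145HeadStruct.…_two_le_struct` ∘ g18's
  `BIJ88Ineq5144TwoCubeChi.two_le_of_three_le_chi`.
* §2 **`eq5145_three_le_chi_fin2_coupled_uniform`** — KERNEL CERTIFICATE OF §1 WITH A THRESHOLD CHOSEN BEFORE THE DATUM, on two abutting cubes with the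
  COUPLED precision `!![2, 1; 1, 2]` (the datum of g17's `eq5145_three_le_fin2_coupled_uniform`: sites = cubes = `Fin 2`, `ℱ = 0`, one linear χ-slot per
  cube, `c ≡ 1`, no interaction terms, `χ = gevreyCutoff`, `𝒫^L = 0`, `W₆″_ρ(X′) = [X′ = ∅]·𝒫̃_ρ`; `m = Λ = 1`, `F = 0`, `G = 1`, `K₁ = 0`, `D = 2`,
  `θ = e_k^{1/4}`, `β′ = 1`): EVERY hypothesis of §1 discharged (`hreg₂` by the threshold at order `n̄+3`; `hχβ`: `2e_k ≤ 16e_k ≤ √e_k ≤ θ` from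
  `256e_k ≤ 1`; `h5144three` vacuous on `Fin 2`); the statement carries the two ADDED clauses, evaluated on the datum, as conjuncts next to the (5.14.5)
  identity (their joint satisfiability with everything else is thus displayed, and the proposition differs from g17's certificate of the old head).
HONEST SCOPE: exactly §1's displayed scope; SIZE bookkeeping of the added clauses is print's (*"extremely small factors"*), the MECHANISM paying the
undecorated cube of a pair with a χ-derivative (a spare Gaussian shell power, `BIJ88OneCubeSpareShell309`) is NOT print's p. 307 join; the V-half of C5
stays a declared divergence from print's constants, forced at model level; the inductive decay on `|X_β| ≥ 3` (print: *"similar to the one for g₂"*) is NOT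
proved and is vacuous on the certificate.  0 `sorry`, 0 definitions, 0 `Prop` facts (D-0026); imports `BIJ88Eq5145HeadThreeCube` (p36 g17, unchanged) and
`BIJ88Ineq5144TwoCubeChi` (p36 g18); modifies nothing.  NOT summit progress; NOT continuum; NOT Clay.  Cell `lit-balaban` Phase 2, seat p36 gen 18 (owner
r16 — the head pointer is the owner's call; referee ref-5).
-/

noncomputable section

open Finset MeasureTheory Matrix ProbabilityTheory Filter
open Literature.MathematicalPhysics.QuantumFieldTheory.BalabanImbrieJaffe1984to88
open BIJ88PolymerRep5134 (g1 IsAdmissible corner)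
open BIJ88PolymerRep5134Gauss (ext expect zG src)
open BIJ88Resummation5141 (outer lam12)
open BIJ88Resummation5141Adm (lam12')
open BIJ88Expansion5143Gauss (fD)
open BIJ88SlotMomentsGauss308 (uD fieldLaw)
open BIJ88Sect2Statements (pLog)
open BIJ88Sect5Statements (CutoffProfile cutoff)
open BIJ88Sect5StatementsPart4 (pertP)
open BIJ88Eq5145CornerModel
open BIJ88Eq5145CornerUrsell (cubeIn)
open BIJ88W6PrimeVsupp (actIn W6v)
open BIJ88Ineq5144Located (locAct)
open BIJ88Eq5145HeadStruct (eq5145_zG_mod_W6v_of_ineq5144_two_le_struct)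
open BIJ88GaussIntegration309Product (exists_const_all_orders)
open BIJ88CutoffProfileWitness (gevreyCutoff chi1_nonneg)
open BIJ88SmallChargeRegime (exists_threshold eventually_const_le_mul_log_rpow eventually_const_mul_le_one eventually_le_one)
open BIJ88Ineq5144TwoCubeChi (two_le_of_three_le_chi)
open BIJ88Ineq5144TwoCubeLeaf (fin2Coupling_posDef_and_ge)

namespace Literature.MathematicalPhysics.QuantumFieldTheory.BalabanImbrieJaffe1984to88.BIJ88Eq5145HeadThreeCubeChi

/-! ## §1 The head `…_three_le_struct` with C5 narrowed to its V-half -/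

section Head

variable {α I : Type} [Fintype α] [DecidableEq α] [Fintype I] [DecidableEq I]
  (blk : α → I) (Δ : Matrix α α ℝ) (ℱ : α → ℝ)
variable (adj : I → I → Prop) [DecidableRel adj]
variable (χ : CutoffProfile) {ι υ : Type*} [DecidableEq ι] [DecidableEq υ]
variable {p ek : ℝ} {B : Finset ι} {Φ : ι → (α → ℝ) → ℝ} {c : ι → ℝ} {Ys : Finset υ} {V : υ → (α → ℝ) → ℝ}
variable (cube : ↥B ⊕ ↥Ys → I) {L : Type*} (γ : L → ↥B ⊕ ↥Ys)

/-- **(5.14.5) ON THE MODEL — THE HEAD `…_three_le_struct` WITH THE χ-HALF OF ITS ADJUSTMENT REMOVED** (p. 312 (5.14.5); p. 309 (5.14.4)):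
`BIJ88Eq5145HeadThreeCube.eq5145_zG_mod_W6v_of_ineq5144_three_le_struct` with `hekθ₂ : e_k ≤ θ^{1+β′}/2` REMOVED (the χ-derivatives cost print's factor
through `hekθ : e_k ≤ θ`, p. 309 *"ct^{−n}e^{−cp(te_k)²} ≦ (e^β(L^kε/ε₀)^{1/4−α})ⁿ"*), `hreg` REPLACED by `hreg₂` (one order more of the Gaussian shell) and
`hχβ : 2e_k ≤ θ^{β′}` ADDED (p. 307 *"extremely small factors when a χ′-factor is replaced by 1"*, p. 309 *"a small power of e_k easily beat[s] …"*), the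
V-half `hKθ₂ : K_Y e^{2GK₁} ≤ θ^{1+β′}/2` KEPT (p. 310 *"(We allow adjustments in β, α, β′, keeping them small.)"*; forced at model level, G-C2-p36-09);
everything else and the conclusion verbatim. [cite: BalabanImbrieJaffe1988, (5.14.5) p.312; (5.14.4) p.309; p.307 (Sect. 5.13); p.310 display 4 and
the parenthesis following it; p.311] -/
theorem eq5145_zG_mod_W6v_of_ineq5144_three_le_struct_chi [Fintype ι] [Fintype υ] {nbr : I → Finset I} {D : ℕ} {θ β' : ℝ}
    (hR : ∀ x y, adj x y → adj y x) (hD : ∀ x, (nbr x).card ≤ D) (hnbr : ∀ x y, adj x y → y ∈ nbr x) (hθ0 : 0 < θ) (hθ1 : θ ≤ 1)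
    (hβ : 0 ≤ β') (hsmall : 16 * ((D : ℝ) + 1) ^ 2 * (θ ^ (β' / 2) * Real.exp 2) ≤ 1)
    (hΔadj : ∀ x y, blk x ≠ blk y → ¬ adj (blk x) (blk y) → Δ x y = 0) (hΔ : Δ.PosDef)
    {m : ℝ} (hm : 0 < m) (hΔm : ∀ φ : α → ℝ, m * (φ ⬝ᵥ φ) ≤ φ ⬝ᵥ (Δ *ᵥ φ))
    (hχ : ∀ x, 0 ≤ χ.χ₁ x) (hp : 1 / 2 < p) {Λ : ℝ} (hΛ : 0 < Λ)
    (hmod : ∀ b ∈ B, ∃ ℓ₁ ℓ₂ : (α → ℝ) → ℝ, IsLinearMap ℝ ℓ₁ ∧ IsLinearMap ℝ ℓ₂ ∧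
      ((∀ φ, Φ b φ = ℓ₁ φ) ∨ (∀ φ, Φ b φ = Real.sqrt (ℓ₁ φ ^ 2 + ℓ₂ φ ^ 2))) ∧
      (∀ φ, |ℓ₁ φ| ≤ Λ * Real.sqrt (φ ⬝ᵥ φ)) ∧ (∀ φ, |ℓ₂ φ| ≤ Λ * Real.sqrt (φ ⬝ᵥ φ)))
    {F : ℝ} (hF0 : 0 ≤ F) (hF : ∀ i : I, src blk ℱ {i} ⬝ᵥ src blk ℱ {i} ≤ F ^ 2)
    {c₀ : ℝ} (hc₀ : 0 < c₀) (hcb : ∀ b ∈ B, c₀ ≤ c b) (hV : ∀ Y ∈ Ys, Measurable (V Y)) {KY : υ → ℝ} (hK : ∀ Y ∈ Ys, ∀ φ, |V Y φ| ≤ KY Y)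
    (hek : 0 < ek) (hek1 : ek < Real.exp (-1))
    (hΦloc : ∀ b : B, ∀ φ ψ : α → ℝ, (∀ x, blk x = cube (Sum.inl b) → φ x = ψ x) → Φ b φ = Φ b ψ)
    (hVloc : ∀ Y : Ys, ∀ φ ψ : α → ℝ, (∀ x, blk x = cube (Sum.inr Y) → φ x = ψ x) → V Y φ = V Y ψ)
    (F' : I → (α → ℝ) → ℝ) (hFloc : ∀ i (φ ψ : α → ℝ), (∀ x, blk x = i → φ x = ψ x) → F' i φ = F' i ψ)
    {L' : Type} [Fintype L'] [DecidableEq L'] {nbar : ℕ} (hL : Fintype.card L' = nbar + 1)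
    (W Bl : Finset I) (Vconst PL : ℝ) (W6pp : Finset (Finset I) → Finset I → ℝ)
    {C : ℝ} (hC1 : 1 ≤ C)
    (hC : ∀ i, i ≤ nbar + 1 → ∀ (A : ℝ) ⦃q e t : ℝ⦄, q ≠ 0 → 0 < e → 0 < t → t * e ≤ Real.exp (-1) →
      |iteratedDeriv i (fun s => cutoff χ (q * pLog p (s * e)) A) t| ≤ C * t ^ (-(i : ℤ)))
    {K₁ : ℝ} (hK₁0 : 0 ≤ K₁) (hK₁ : ∀ Y ∈ Ys, KY Y ≤ K₁) {G : ℕ} (hG : ∀ i, (univ.filter fun τ : ↥B ⊕ ↥Ys => cube τ = i).card ≤ G)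
    (hekθ : ek ≤ θ) (hreg₂ : ((nbar + 1 : ℕ) : ℝ) + 2 ≤ m / (8 * Λ ^ 2) * (81 / 100) * c₀ ^ 2 * Real.log ek⁻¹ ^ (2 * p - 1))
    -- the one-cube regime (gens 15/16)
    (hpre : C ^ (nbar + 1) * (4 * Real.exp (F ^ 2 / (2 * m))) * Real.exp (G * K₁) * ek ≤ 1) (hKθ : ∀ Y ∈ Ys, KY Y * Real.exp (G * K₁) ≤ θ)
    (hvac : Real.exp (G * K₁) * G * (4 * Real.exp (F ^ 2 / (2 * m))) * ek + (Real.exp (G * K₁) - 1) ≤ θ ^ β')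
    -- the two-cube regime (gens 17/18): one spare shell factor for the undecorated cube; the V-half of the declared adjustment kept
    (hpre₂ : C ^ (nbar + 1) * (4 * Real.exp (F ^ 2 / m)) * Real.exp (2 * G * K₁) * ek ≤ 1)
    (hvac₂ : Real.exp (2 * G * K₁) * (2 * G) * (4 * Real.exp (F ^ 2 / m)) * ek + (Real.exp (2 * G * K₁) - 1) ≤ θ ^ (2 * β') / 2)
    (hχβ : 2 * ek ≤ θ ^ β') (hKθ₂ : ∀ Y ∈ Ys, KY Y * Real.exp (2 * G * K₁) ≤ θ ^ (1 + β') / 2)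
    -- (5.14.4) on the polymers with at least THREE cubes, located reading, for the data of every sub-region of `Λ₁₂` at every `t ∈ (0,1]`
    (h5144three : ∀ ρ ∈ (outer W Bl).filter (IsAdmissible adj), ∀ X' ⊆ lam12 W ρ, ∀ t ∈ Set.Ioc (0 : ℝ) 1,
      ∀ γ' : L' → ↥(slotB B Ys cube X') ⊕ ↥(slotY B Ys cube X'), ∀ (H : Finset L') (X'' : Finset I), 3 ≤ X''.card →
        |locAct (cubeIn cube X' ∘ γ') (actIn blk Δ ℱ adj χ p ek B Φ c Ys V cube (lam12' adj W ρ) X' t γ') H X''| ≤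
          θ ^ ((H.card : ℝ) + β' * ((X'' \ H.image (cubeIn cube X' ∘ γ')).card : ℝ)))
    (h311 : ∀ ρ ∈ (outer W Bl).filter (IsAdmissible adj),
      Vconst + pertP (fun t => Real.log (ztIn blk Δ ℱ χ p ek B Φ c Ys V cube (lam12 W ρ) (lam12' adj W ρ) t)) nbar =
        PL + ∑ X' : Finset I, W6pp ρ X') :
    Real.exp (-Vconst) * expect blk Δ ℱ (fun i φ => fD (uD χ p ek B Φ c Ys V 1) cube γ ∅ i φ * F' i φ) W (corner ℝ W) =
      ∑ ρ ∈ (outer W Bl).filter (IsAdmissible adj),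
        (∏ X ∈ ρ, g1 adj (zG blk Δ ℱ (fun i φ => fD (uD χ p ek B Φ c Ys V 1) cube γ ∅ i φ * F' i φ)) X) *
          (zG blk Δ ℱ (fun i φ => fD (uD χ p ek B Φ c Ys V 1) cube γ ∅ i φ * F' i φ) (lam12 W ρ) (lam12' adj W ρ) /
              zG blk Δ ℱ (fD (uD χ p ek B Φ c Ys V 1) cube γ ∅) (lam12 W ρ) (lam12' adj W ρ) *
            Real.exp (-PL - ∑ X' : Finset I,
              (W6v blk Δ ℱ adj χ p ek B Φ c Ys V cube (lam12' adj W ρ) (lam12 W ρ) L' nbar X' + W6pp ρ X'))) :=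
  eq5145_zG_mod_W6v_of_ineq5144_two_le_struct blk Δ ℱ adj χ cube γ hR hD hnbr hθ0 hθ1 hβ hsmall hΔadj hΔ hm hΔm hχ hp hΛ hmod hF0 hF hc₀
    hcb hV hK hek hek1 hΦloc hVloc F' hFloc hL W Bl Vconst PL W6pp hC1 hC hK₁0 hK₁ hG hekθ (le_trans (by linarith) hreg₂) hpre hKθ hvac
    (fun ρ hρ X' hX' t ht γ' H X'' h2 =>
      two_le_of_three_le_chi blk Δ ℱ adj χ cube hp hC1 hC hΔ hm hΔm hχ hc₀ hcb hΛ hmod hF0 hF hV hK hK₁0 hK₁ hG hek hek1.le hθ0 hθ1 hβ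
        hreg₂ hpre₂ hvac₂ hekθ hχβ hKθ₂ (lam12' adj W ρ) X' ht hL.le γ' (h5144three ρ hρ X' hX' t ht γ') H X'' h2)
    h311

end Head

/-! ## §2 A kernel certificate of §1 on two abutting cubes with a coupled precision, uniform threshold -/

/-- **KERNEL CERTIFICATE OF §1, COUPLED PRECISION, THRESHOLD BEFORE THE DATUM**: for `p > 1/2` and `n̄` there is `e₀ > 0` such that for every
cube map of the form `Sum.inl b ↦ b` on `Fin 2`, every cube-local `F`, every `e_k ∈ (0, e₀)`, `W`, `B_large`, `|L′| = n̄+1`, `γ`, the (5.14.5) identity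
of §1 holds for the data «sites = cubes = `Fin 2`, abutting = `≠`, precision `!![2, 1; 1, 2]` (COUPLED), `ℱ = 0`, one linear χ-slot per cube, `c ≡ 1`,
no interaction terms, `χ = gevreyCutoff`, `𝒫^L = 0`, `W₆″_ρ(X′) = [X′ = ∅]·𝒫̃_ρ`» — EVERY hypothesis of §1 discharged with `m = Λ = 1`, `F = 0`, `G = 1`,
`K₁ = 0`, `c₀ = 1`, `D = 2`, `θ = e_k^{1/4}`, `β′ = 1`, the all-orders constant `Ĉ(gevreyCutoff, p, n̄+1)`; the threshold carries the shell regime at order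
`n̄+3` (`hreg₂`) and `256e_k ≤ 1` gives `hχβ : 2e_k ≤ 16e_k ≤ √e_k ≤ θ`; `h5144three` holds vacuously (no polymer of `Fin 2` has three cubes).
[cite: BalabanImbrieJaffe1988, (5.14.5) p.312; (5.14.4) p.309; p.307 (Sect. 5.13)] -/
theorem eq5145_three_le_chi_fin2_coupled_uniform {p : ℝ} (hp : 1 / 2 < p) (nbar : ℕ) :
    ∃ e₀ : ℝ, 0 < e₀ ∧ ∀ {cube : ↥(univ : Finset (Fin 2)) ⊕ ↥(∅ : Finset (Fin 2)) → Fin 2} (_ : ∀ b, cube (Sum.inl b) = b.1)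
        (F : Fin 2 → (Fin 2 → ℝ) → ℝ) (_ : ∀ i (φ ψ : Fin 2 → ℝ), (∀ x, x = i → φ x = ψ x) → F i φ = F i ψ) ⦃e : ℝ⦄, 0 < e → e < e₀ →
      ∀ (W Bl : Finset (Fin 2)) {L' : Type} [Fintype L'] [DecidableEq L'] (_ : Fintype.card L' = nbar + 1)
        {L : Type} (γ : L → ↥(univ : Finset (Fin 2)) ⊕ ↥(∅ : Finset (Fin 2))),
        -- the two ADDED clauses of §1 hold on the datum (`θ = e^{1/4}`, `β′ = 1`, `m = Λ = c₀ = 1`) …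
        ((((nbar + 1 : ℕ) : ℝ) + 2 ≤ 1 / (8 * (1 : ℝ) ^ 2) * (81 / 100) * (1 : ℝ) ^ 2 * Real.log e⁻¹ ^ (2 * p - 1)) ∧
          2 * e ≤ Real.sqrt (Real.sqrt e) ^ (1 : ℝ)) ∧
        -- … and the (5.14.5) identity of §1 holds for it
        Real.exp (-0) * expect (id : Fin 2 → Fin 2) (!![2, 1; 1, 2] : Matrix (Fin 2) (Fin 2) ℝ) (0 : Fin 2 → ℝ)
            (fun i φ => fD (uD gevreyCutoff p e (univ : Finset (Fin 2)) (fun (i : Fin 2) (φ : Fin 2 → ℝ) => φ i) (fun _ => (1 : ℝ))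
              (∅ : Finset (Fin 2)) (fun (_ : Fin 2) (_ : Fin 2 → ℝ) => (0 : ℝ)) 1) cube γ ∅ i φ * F i φ) W (corner ℝ W) =
          ∑ ρ ∈ (outer W Bl).filter (IsAdmissible (fun x y : Fin 2 => x ≠ y)),
            (∏ X ∈ ρ, g1 (fun x y : Fin 2 => x ≠ y) (zG (id : Fin 2 → Fin 2) (!![2, 1; 1, 2] : Matrix (Fin 2) (Fin 2) ℝ) (0 : Fin 2 → ℝ)
              (fun i φ => fD (uD gevreyCutoff p e (univ : Finset (Fin 2)) (fun (i : Fin 2) (φ : Fin 2 → ℝ) => φ i) (fun _ => (1 : ℝ))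
                (∅ : Finset (Fin 2)) (fun (_ : Fin 2) (_ : Fin 2 → ℝ) => (0 : ℝ)) 1) cube γ ∅ i φ * F i φ)) X) *
              (zG (id : Fin 2 → Fin 2) (!![2, 1; 1, 2] : Matrix (Fin 2) (Fin 2) ℝ) (0 : Fin 2 → ℝ)
                  (fun i φ => fD (uD gevreyCutoff p e (univ : Finset (Fin 2)) (fun (i : Fin 2) (φ : Fin 2 → ℝ) => φ i) (fun _ => (1 : ℝ))
                    (∅ : Finset (Fin 2)) (fun (_ : Fin 2) (_ : Fin 2 → ℝ) => (0 : ℝ)) 1) cube γ ∅ i φ * F i φ) (lam12 W ρ)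
                    (lam12' (fun x y : Fin 2 => x ≠ y) W ρ) /
                  zG (id : Fin 2 → Fin 2) (!![2, 1; 1, 2] : Matrix (Fin 2) (Fin 2) ℝ) (0 : Fin 2 → ℝ)
                    (fD (uD gevreyCutoff p e (univ : Finset (Fin 2)) (fun (i : Fin 2) (φ : Fin 2 → ℝ) => φ i) (fun _ => (1 : ℝ))
                      (∅ : Finset (Fin 2)) (fun (_ : Fin 2) (_ : Fin 2 → ℝ) => (0 : ℝ)) 1) cube γ ∅) (lam12 W ρ)
                      (lam12' (fun x y : Fin 2 => x ≠ y) W ρ) *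
                Real.exp (-0 - ∑ X' : Finset (Fin 2),
                  (W6v (id : Fin 2 → Fin 2) (!![2, 1; 1, 2] : Matrix (Fin 2) (Fin 2) ℝ) (0 : Fin 2 → ℝ) (fun x y : Fin 2 => x ≠ y)
                      gevreyCutoff p e (univ : Finset (Fin 2)) (fun (i : Fin 2) (φ : Fin 2 → ℝ) => φ i) (fun _ => (1 : ℝ)) (∅ : Finset (Fin 2))
                      (fun (_ : Fin 2) (_ : Fin 2 → ℝ) => (0 : ℝ)) cube (lam12' (fun x y : Fin 2 => x ≠ y) W ρ) (lam12 W ρ) L' nbar X' +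
                    (if X' = ∅ then pertP (fun t => Real.log (ztIn (id : Fin 2 → Fin 2) (!![2, 1; 1, 2] : Matrix (Fin 2) (Fin 2) ℝ)
                      (0 : Fin 2 → ℝ) gevreyCutoff p e (univ : Finset (Fin 2)) (fun (i : Fin 2) (φ : Fin 2 → ℝ) => φ i) (fun _ => (1 : ℝ))
                      (∅ : Finset (Fin 2)) (fun (_ : Fin 2) (_ : Fin 2 → ℝ) => (0 : ℝ)) cube (lam12 W ρ)
                      (lam12' (fun x y : Fin 2 => x ≠ y) W ρ) t)) nbar else 0)))) := by
  classical
  -- the all-orders constant of the profile for the orders `≤ n̄+1` and gen 5's constant `M = 16(D+1)²e²` at `D = 2`: both BEFORE the threshold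
  obtain ⟨C, hC1, hC⟩ := exists_const_all_orders gevreyCutoff p (nbar + 1)
  set M : ℝ := 16 * ((2 : ℝ) + 1) ^ 2 * Real.exp 2 with hM
  have hM0 : 0 < M := by positivity
  have hκ0 : 0 < 1 / (8 * (1 : ℝ) ^ 2) * (81 / 100) * (1 : ℝ) ^ 2 := by positivity
  obtain ⟨δ, hδ, hreg⟩ := exists_threshold (Q := fun x : ℝ =>
      (((nbar + 1 : ℕ) : ℝ) + 2 ≤ 1 / (8 * (1 : ℝ) ^ 2) * (81 / 100) * (1 : ℝ) ^ 2 * Real.log x⁻¹ ^ (2 * p - 1)) ∧ 2 * Real.exp 1 * x ≤ 1 ∧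
        C ^ (nbar + 1) * 4 * x ≤ 1 ∧ 256 * x ≤ 1 ∧ M ^ 8 * x ≤ 1 ∧ x ≤ 1) (by
    filter_upwards [eventually_const_le_mul_log_rpow (((nbar + 1 : ℕ) : ℝ) + 2) _ (2 * p - 1) hκ0 (by linarith),
      eventually_const_mul_le_one (2 * Real.exp 1), eventually_const_mul_le_one (C ^ (nbar + 1) * 4), eventually_const_mul_le_one 256,
      eventually_const_mul_le_one (M ^ 8), eventually_le_one] with x h1 h2 h3 h4 h5 h6
    exact ⟨h1, h2, h3, h4, h5, h6⟩)
  refine ⟨δ, hδ, ?_⟩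
  intro cube hcube F hFloc e he heδ W Bl L' _ _ hL L γ
  obtain ⟨h1, h2, h3, h4, h5, h6⟩ := hreg e he heδ
  -- elementary consequences of the regime (`θ = e^{1/4} = √√e`)
  have hek1 : e < Real.exp (-1) := by
    rw [Real.exp_neg, ← one_div, lt_div_iff₀ (Real.exp_pos 1)]
    nlinarith [Real.exp_pos 1]
  set s : ℝ := Real.sqrt e with hs
  set θ : ℝ := Real.sqrt s with hθ
  have hs0 : 0 < s := Real.sqrt_pos.2 he
  have hθ0 : 0 < θ := Real.sqrt_pos.2 hs0
  have hss : s * s = e := Real.mul_self_sqrt he.le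
  have hθθ : θ * θ = s := Real.mul_self_sqrt hs0.le
  have hs16 : s ≤ 1 / 16 := by
    have h16 : e ≤ (1 / 16) ^ 2 := by nlinarith
    calc s ≤ Real.sqrt ((1 / 16) ^ 2) := Real.sqrt_le_sqrt h16
      _ = 1 / 16 := Real.sqrt_sq (by norm_num)
  have hs1 : s ≤ 1 := by linarith
  have hθ1 : θ ≤ 1 := by rw [hθ, ← Real.sqrt_one]; exact Real.sqrt_le_sqrt hs1
  have hes : e ≤ s := by nlinarith
  have hsθ : s ≤ θ := by nlinarith
  have hθsq' : θ ^ ((2 : ℝ) * 1) = s := by rw [mul_one, show (2 : ℝ) = (2 : ℕ) by norm_num, Real.rpow_natCast, pow_two, hθθ]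
  have hsmall : 16 * (((2 : ℕ) : ℝ) + 1) ^ 2 * (θ ^ ((1 : ℝ) / 2) * Real.exp 2) ≤ 1 := by
    have hx : e ≤ (((1 / M) ^ 2) ^ 2) ^ 2 := by
      rw [← pow_mul, ← pow_mul, show 2 * 2 * 2 = 8 by norm_num, div_pow, one_pow, le_div_iff₀ (pow_pos hM0 8)]; linarith
    have hs1' : s ≤ ((1 / M) ^ 2) ^ 2 := (Real.sqrt_le_left (by positivity)).2 hx
    have hs2 : θ ≤ (1 / M) ^ 2 := (Real.sqrt_le_left (by positivity)).2 hs1'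
    have hs3 : Real.sqrt θ ≤ 1 / M := (Real.sqrt_le_left (by positivity)).2 hs2
    rw [← Real.sqrt_eq_rpow]
    calc 16 * (((2 : ℕ) : ℝ) + 1) ^ 2 * (Real.sqrt θ * Real.exp 2) = M * Real.sqrt θ := by rw [hM]; push_cast; ring
      _ ≤ M * (1 / M) := by gcongr
      _ = 1 := by field_simp
  -- the structural data: `Δ = !![2,1;1,2] ≥ 1·1`, slot fields = coordinates (`Λ = 1`), `ℱ = 0` (`F = 0`), one slot per cube, `adj = ≠`
  obtain ⟨hΔ, hΔm⟩ := fin2Coupling_posDef_and_ge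
  have hlin : ∀ i : Fin 2, IsLinearMap ℝ (fun φ : Fin 2 → ℝ => φ i) := fun i => (LinearMap.proj (R := ℝ) (φ := fun _ : Fin 2 => ℝ) i).isLinear
  have hΛ : ∀ (i : Fin 2) (φ : Fin 2 → ℝ), |φ i| ≤ 1 * Real.sqrt (φ ⬝ᵥ φ) := fun i φ => by
    rw [one_mul]
    refine Real.abs_le_sqrt ?_
    rw [pow_two]
    exact Finset.single_le_sum (f := fun j => φ j * φ j) (fun j _ => mul_self_nonneg (φ j)) (mem_univ i)
  have hF : ∀ i : Fin 2, src (id : Fin 2 → Fin 2) (0 : Fin 2 → ℝ) {i} ⬝ᵥ src (id : Fin 2 → Fin 2) (0 : Fin 2 → ℝ) {i} ≤ (0 : ℝ) ^ 2 :=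
    fun i => by simp [BIJ88PolymerRep5134Gauss.src, dotProduct]
  have hG : ∀ i : Fin 2, (univ.filter fun τ : ↥(univ : Finset (Fin 2)) ⊕ ↥(∅ : Finset (Fin 2)) => cube τ = i).card ≤ 1 := fun i =>
    card_le_one.2 fun a ha b hb => by
      obtain ⟨-, ha⟩ := mem_filter.1 ha
      obtain ⟨-, hb⟩ := mem_filter.1 hb
      rcases a with a | a
      · rcases b with b | b
        · rw [hcube] at ha hb
          rw [Subtype.ext (ha.trans hb.symm)]
        · exact absurd b.2 (notMem_empty _)
      · exact absurd a.2 (notMem_empty _)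
  -- the regime inequalities of §1 (`G = 1`, `K₁ = 0`, `m = Λ = 1`, `F = 0`, `θ = e^{1/4}`, `β′ = 1`)
  have hA1 : (4 * Real.exp ((0 : ℝ) ^ 2 / (2 * 1))) = 4 := by simp
  have hA2 : (4 * Real.exp ((0 : ℝ) ^ 2 / 1)) = 4 := by simp
  have hW1 : Real.exp (((1 : ℕ) : ℝ) * 0) = 1 := by simp
  have hW2 : Real.exp (2 * ((1 : ℕ) : ℝ) * 0) = 1 := by simp
  have hpre : C ^ (nbar + 1) * (4 * Real.exp ((0 : ℝ) ^ 2 / (2 * 1))) * Real.exp (((1 : ℕ) : ℝ) * 0) * e ≤ 1 := by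
    rw [hA1, hW1, mul_one]; exact h3
  have hpre₂ : C ^ (nbar + 1) * (4 * Real.exp ((0 : ℝ) ^ 2 / 1)) * Real.exp (2 * ((1 : ℕ) : ℝ) * 0) * e ≤ 1 := by
    rw [hA2, hW2, mul_one]; exact h3
  have hvac : Real.exp (((1 : ℕ) : ℝ) * 0) * ((1 : ℕ) : ℝ) * (4 * Real.exp ((0 : ℝ) ^ 2 / (2 * 1))) * e + (Real.exp (((1 : ℕ) : ℝ) * 0) - 1) ≤
      θ ^ (1 : ℝ) := by
    rw [hA1, hW1, Real.rpow_one]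
    norm_num
    nlinarith
  have hvac₂ : Real.exp (2 * ((1 : ℕ) : ℝ) * 0) * (2 * ((1 : ℕ) : ℝ)) * (4 * Real.exp ((0 : ℝ) ^ 2 / 1)) * e +
      (Real.exp (2 * ((1 : ℕ) : ℝ) * 0) - 1) ≤ θ ^ ((2 : ℝ) * 1) / 2 := by
    rw [hA2, hW2, hθsq']
    norm_num
    nlinarith
  have hχβ : 2 * e ≤ θ ^ (1 : ℝ) := by rw [Real.rpow_one]; nlinarith [hss, hs16, hsθ, hs0.le]
  have hreg' : ((nbar + 1 : ℕ) : ℝ) + 2 ≤ 1 / (8 * (1 : ℝ) ^ 2) * (81 / 100) * (1 : ℝ) ^ 2 * Real.log e⁻¹ ^ (2 * p - 1) := h1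
  have hnbr : ∀ x y : Fin 2, x ≠ y → y ∈ (univ : Finset (Fin 2)) := fun _ y _ => mem_univ y
  have hD : ∀ x : Fin 2, (univ : Finset (Fin 2)).card ≤ 2 := fun _ => by simp
  refine ⟨⟨h1, hχβ⟩, ?_⟩
  exact eq5145_zG_mod_W6v_of_ineq5144_three_le_struct_chi (id : Fin 2 → Fin 2) _ (0 : Fin 2 → ℝ) (fun x y : Fin 2 => x ≠ y) gevreyCutoff cube γ
    (nbr := fun _ => univ) (D := 2) (θ := θ) (β' := 1) (fun x y h => Ne.symm h) hD hnbr hθ0 hθ1 zero_le_one hsmall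
    (fun x y hxy hn => absurd hxy hn) hΔ (m := 1) one_pos hΔm chi1_nonneg hp (Λ := 1) one_pos
    (fun b _ => ⟨fun φ => φ b, fun φ => φ b, hlin b, hlin b, Or.inl fun _ => rfl, hΛ b, hΛ b⟩) (F := 0) le_rfl hF (c₀ := 1) one_pos
    (fun _ _ => le_rfl) (fun Y hY => absurd hY (notMem_empty Y)) (KY := fun _ => 0) (fun Y hY => absurd hY (notMem_empty Y)) he hek1
    (fun b φ ψ h => h b.1 (by rw [hcube]; rfl)) (fun Y => absurd Y.2 (notMem_empty _)) F (fun i φ ψ h => hFloc i φ ψ fun x hx => h x hx)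
    hL W Bl 0 0
    (fun ρ X' => if X' = ∅ then pertP (fun t => Real.log (ztIn (id : Fin 2 → Fin 2) (!![2, 1; 1, 2] : Matrix (Fin 2) (Fin 2) ℝ)
      (0 : Fin 2 → ℝ) gevreyCutoff p e (univ : Finset (Fin 2)) (fun (i : Fin 2) (φ : Fin 2 → ℝ) => φ i) (fun _ => (1 : ℝ))
      (∅ : Finset (Fin 2)) (fun (_ : Fin 2) (_ : Fin 2 → ℝ) => (0 : ℝ)) cube (lam12 W ρ) (lam12' (fun x y : Fin 2 => x ≠ y) W ρ) t)) nbar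
      else 0)
    hC1 hC (K₁ := 0) le_rfl (fun Y hY => absurd hY (notMem_empty Y)) (G := 1) hG (hes.trans hsθ) hreg' hpre
    (fun Y hY => absurd hY (notMem_empty Y)) hvac hpre₂ hvac₂ hχβ (fun Y hY => absurd hY (notMem_empty Y))
    (fun ρ _ X' _ t _ γ' H X'' hX'' => absurd ((card_le_univ X'').trans (Fintype.card_fin 2).le) (by omega))
    (fun ρ _ => by simp)

end Literature.MathematicalPhysics.QuantumFieldTheory.BalabanImbrieJaffe1984to88.BIJ88Eq5145HeadThreeCubeChi

end
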